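import Summits.BirchSwinnertonDyer.BirchSwinnertonDyer.Theses.TameQuarticSolvent
import HarnessLib

/-!
# Route `TameQuarticSolvent` — closer of the glue item 24526 `TprimeRankOneUpperAtThreeOfManinParity`

Cell `bsd-wall` (W-ALL lane 3, row 2 @3 TQS col), seat `bsd-wall-utd-s2` g0 (prover; the pen's «any idle prover:
ONE-LINER glue 24526», bus 2026-08-28T01:51:16Z), `--workitem stmt-BirchSwinnertonDyer-24526`.

Crux #3 `TprimeRankOneUpperAtThree` (item 21392) of the route was SPLIT (rev 5) BY NAME onto route
`TameQuarticManinParity`'s vetted items: children `TprimeIrreducibleManinUnit` (C₁, 23736),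
`TprimeReducibleManinUnit` (C₂, 23737), `TprimeHeegnerUpperOfManinUnit` (C₃, 23738) — and C₃ is LITERALLY
`C₁ → C₂ → (21392's text verbatim)`. So the generated glue `C₁ → C₂ → C₃ → TprimeRankOneUpperAtThree` is modus
ponens. An IMPLICATION between route items; none of C₁, C₂, C₃ is proved here; BSD is not proved for any curve by
this file. THEOREM ONLY (0 definitions, 0 named facts, 0 `sorry`). Beyond-print theorem: NO.
-/

set_option autoImplicit false
-- `…BirchSwinnertonDyer.BirchSwinnertonDyer.Theorems…` is the problem's mandated namespace (D-0017).
set_option linter.dupNamespace false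

namespace Summit.BirchSwinnertonDyer.BirchSwinnertonDyer.Theorems

/-- **Item 24526 holds** (glue of the by-name split of TQS crux #3): `TprimeHeegnerUpperOfManinUnit` unfolds to
`TprimeIrreducibleManinUnit → TprimeReducibleManinUnit → TprimeRankOneUpperAtThree`, so the parent follows from the
three children by modus ponens. [folklore] -/
theorem tprimeRankOneUpperAtThreeOfManinParity_proof :
    Summit.BirchSwinnertonDyer.BirchSwinnertonDyer.Theses.TameQuarticSolvent.TprimeRankOneUpperAtThreeOfManinParity :=
  fun h₁ h₂ h₃ ↦ h₃ h₁ h₂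

end Summit.BirchSwinnertonDyer.BirchSwinnertonDyer.Theorems
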